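import Literature.Combinatorics.Additive.RaikovKneserCircle
import HarnessLib

/-!
# Density of sum-free sets: `ℤ/pℤ` and the circle `ℝ/Tℤ`

A set `A` in an additive group is *sum-free* if `x + y ∉ A` for all `x, y ∈ A` (no solution of
`x + y = z` in `A`). Two classical consequences of the Cauchy–Davenport / Raikov–Kneser sumset
inequalities, both PROVED here:

* `ZMod.three_mul_card_le_of_sumFree` — **`ℤ/pℤ`, `p` prime: a sum-free `A ⊆ ℤ/pℤ` has
  `|A| ≤ ⌊(p+1)/3⌋`**, rendered `3|A| ≤ p + 1`. [cite: DeshouillersLev2008, §1] ("The well-known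
  Cauchy–Davenport inequality implies readily that if `A ⊆ ℤ_p` is sum-free, then `|A| ≤ ⌊(p+1)/3⌋`.
  This estimate is sharp, as for `u = ⌊(p+1)/3⌋` the set `[u, 2u−1]_p`, and consequently its dilates,
  are sum-free." — the sharpness clause is not formalised.) Proof as printed: `A + A ⊆ ℤ_p ∖ A` and
  Mathlib's `ZMod.cauchy_davenport` `|A + A| ≥ min(p, 2|A| − 1)`.
* `addCircle_three_mul_volume_le_of_sumFree` — **the circle: a measurable sum-free `A ⊆ ℝ/Tℤ` has
  `volume A ≤ T/3`** (`d₁(𝕋) = 1/3`). [cite: CandelaDeRoton2019, §3 (the display before Theorem 3.1)]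
  ("`A` is `k`-sum-free if and only if `(A+A) ∩ k·A = ∅`, and since by Raikov's inequality we have
  `μ(A+A) ≥ 2μ(A)`, it follows that `3μ(A) ≤ μ(A+A) + μ(k·A) = μ((A+A) ∪ k·A) ≤ 1`, so `μ(A) ≤ 1/3`.
  Given this, the problem of determining `d₁(𝕋)` is easily settled: … the interval `(1/3, 2/3)` is a
  sum-free set of maximum measure"; here `k = 1`.) Proof as printed, from the tree's Raikov–Kneser
  inequality `Literature.Combinatorics.Additive.addCircle_min_le_volume_add` (`A + A ⊆ Aᶜ`).

No definitions, no named facts (requested as the `k = 3` calibration rung of the `k`-point-free /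
`TT_k`-free Cayley-digraph ladder of the Parity ideation cell, parity-ideate-p4 ROUND-3/4).
-/

open MeasureTheory Set Finset
open scoped Pointwise

namespace Literature.Combinatorics.Additive

/-! ### `ℤ/pℤ` -/

/-- **Sum-free sets in `ℤ/pℤ` have at most `⌊(p+1)/3⌋` elements** (`p` prime), i.e.
`3|A| ≤ p + 1` for every `A ⊆ ℤ/pℤ` with `x + y ∉ A` for all `x, y ∈ A`; from Cauchy–Davenport.
[cite: DeshouillersLev2008, §1] -/
theorem ZMod.three_mul_card_le_of_sumFree {p : ℕ} (hp : p.Prime) {A : Finset (ZMod p)}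
    (hA : ∀ x ∈ A, ∀ y ∈ A, x + y ∉ A) : 3 * A.card ≤ p + 1 := by
  classical
  haveI : Fact p.Prime := ⟨hp⟩
  rcases A.eq_empty_or_nonempty with rfl | hne
  · simp
  -- `A + A ⊆ univ \\ A`
  have hsub : A + A ⊆ Finset.univ \ A := by
    intro z hz
    rw [Finset.mem_add] at hz
    obtain ⟨x, hx, y, hy, rfl⟩ := hz
    exact Finset.mem_sdiff.2 ⟨Finset.mem_univ _, hA x hx y hy⟩
  have hcard : (A + A).card ≤ p - A.card := by
    have := Finset.card_le_card hsub
    rwa [Finset.card_sdiff_of_subset (Finset.subset_univ A), Finset.card_univ, ZMod.card] at this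
  have hcd := ZMod.cauchy_davenport hp hne hne
  have hAp : A.card ≤ p := by
    have := Finset.card_le_univ A
    rwa [ZMod.card] at this
  rcases le_total p (A.card + A.card - 1) with h | h
  · rw [min_eq_left h] at hcd
    omega
  · rw [min_eq_right h] at hcd
    omega

/-! ### The circle `ℝ/Tℤ` -/

variable {T : ℝ} [hT : Fact (0 < T)]

/-- **Measurable sum-free subsets of the circle `ℝ/Tℤ` have volume `≤ T/3`** (`d₁(𝕋) = 1/3`; the
arc `(T/3, 2T/3)` shows sharpness, not formalised): for measurable `A ⊆ ℝ/Tℤ` with `x + y ∉ A` for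
all `x, y ∈ A`, `3 · volume A ≤ T`. From the Raikov–Kneser inequality
`addCircle_min_le_volume_add` applied to `A + A ⊆ Aᶜ`. [cite: CandelaDeRoton2019, §3] -/
theorem addCircle_three_mul_volume_le_of_sumFree {A : Set (AddCircle T)} (hA : MeasurableSet A)
    (hsf : ∀ x ∈ A, ∀ y ∈ A, x + y ∉ A) : 3 * volume.real A ≤ T := by
  have hTpos : 0 < T := hT.out
  have huniv : volume.real (Set.univ : Set (AddCircle T)) = T := by
    rw [measureReal_def, AddCircle.measure_univ, ENNReal.toReal_ofReal hTpos.le]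
  have hAT : volume.real A ≤ T :=
    (measureReal_mono (Set.subset_univ A) (measure_ne_top _ _)).trans_eq huniv
  have hA0 : 0 ≤ volume.real A := measureReal_nonneg
  rcases A.eq_empty_or_nonempty with rfl | hne
  · simp [hTpos.le]
  have hsub : A + A ⊆ Aᶜ := by
    rintro z ⟨x, hx, y, hy, rfl⟩
    exact hsf x hx y hy
  have hc : volume.real Aᶜ = T - volume.real A := by rw [measureReal_compl hA, huniv]
  have hk := addCircle_min_le_volume_add hA hA hne hne
  have hle : volume.real (A + A) ≤ T - volume.real A :=
    (measureReal_mono hsub (measure_ne_top _ _)).trans_eq hc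
  rcases min_cases T (volume.real A + volume.real A) with ⟨h1, _⟩ | ⟨h1, _⟩
  · rw [h1] at hk
    linarith
  · rw [h1] at hk
    linarith

/-- The same bound in `ℝ≥0∞`: `3 · volume A ≤ T`. [cite: CandelaDeRoton2019, §3] -/
theorem addCircle_three_mul_volume_le_of_sumFree' {A : Set (AddCircle T)} (hA : MeasurableSet A)
    (hsf : ∀ x ∈ A, ∀ y ∈ A, x + y ∉ A) : 3 * volume A ≤ ENNReal.ofReal T := by
  have h := addCircle_three_mul_volume_le_of_sumFree hA hsf
  rw [← ofReal_measureReal (measure_ne_top (volume : Measure (AddCircle T)) A),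
    show (3 : ENNReal) = ENNReal.ofReal 3 by norm_num, ← ENNReal.ofReal_mul (by norm_num)]
  exact ENNReal.ofReal_le_ofReal h

end Literature.Combinatorics.Additive
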